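import Summits.Ventures.HodgeRepro2.T5PoincareInvariance

/-!
# The Poincaré measure of the disc as a measure, and its Möbius invariance

`poincare := (volume.restrict (ball 0 1)).withDensity (1 - |z|²)⁻²` on `ℂ`, the hyperbolic area
measure of the disc.  `T5PoincareInvariance.integral_ball_comp_mobius` is its invariance under the
Möbius action of `SU(1,1)` at the level of Bochner integrals; here the same change of variables
(`MeasureTheory.lintegral_image_eq_lintegral_abs_det_fderiv_mul` on `ℂ = ℝ²`, with
`T5PoincareDensity.density_invariance`) gives the `lintegral` form and the pushforward form
`map (mobius (su11 a b)) poincare = poincare`, which is what the fibration theorem for the Haar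
measure of `SU(1,1)` needs.

Blind lane: Mathlib + own prefix only; no sorry; axioms ⊆ {propext, Classical.choice, Quot.sound}.
-/

namespace Summit.Ventures.HodgeRepro2.T5PoincareMeasure

open MeasureTheory MeasureTheory.Measure Metric T5PoincareDensity T5PoincareInvariance
open scoped ENNReal

/-- The Poincaré density `(1 - |z|²)⁻²` as a real function. -/
noncomputable def dens (z : ℂ) : ℝ := 1 / (1 - Complex.normSq z) ^ 2

/-- `dens` is non-negative. -/
lemma dens_nonneg (z : ℂ) : 0 ≤ dens z := by
  unfold dens; positivity

/-- `dens` is measurable. -/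
lemma measurable_dens : Measurable dens := by
  unfold dens
  fun_prop

/-- `dens` is continuous on the open disc. -/
lemma continuousOn_dens : ContinuousOn dens (ball 0 1) := by
  unfold dens
  apply ContinuousOn.div continuousOn_const
  · fun_prop
  · intro z hz
    rw [mem_ball_iff_normSq] at hz
    have : 0 < 1 - Complex.normSq z := by linarith
    positivity

/-- **The Poincaré measure** of the disc: `(1 - |z|²)⁻² dA` on `ball 0 1 ⊂ ℂ`. -/
noncomputable def poincare : Measure ℂ :=
  (volume.restrict (ball 0 1)).withDensity fun z => ENNReal.ofReal (dens z)

/-- The Möbius map of `su11 a b` is measurable (a rational function of `z`). -/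
lemma measurable_mobius (a b : ℂ) : Measurable (mobius (su11 a b)) := by
  unfold mobius
  fun_prop

/-- The real Fréchet derivative of the Möbius map on the disc: multiplication by
`1 / (b̄ z + ā)²`. -/
lemma hasFDerivWithinAt_mobius {a b : ℂ} (h : Complex.normSq a - Complex.normSq b = 1) {z : ℂ}
    (hz : z ∈ ball 0 1) :
    HasFDerivWithinAt (mobius (su11 a b))
      ((ContinuousLinearMap.toSpanSingleton ℂ
        (1 / ((starRingEnd ℂ) b * z + (starRingEnd ℂ) a) ^ 2)).restrictScalars ℝ) (ball 0 1) z := by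
  rw [mem_ball_iff_normSq] at hz
  exact ((hasDerivAt_mobius_su11 h hz).hasFDerivAt.restrictScalars ℝ).hasFDerivWithinAt

/-- The Jacobian identity `|det (g·)′| · dens (g·z) = dens z` (`density_invariance`). -/
lemma abs_det_mul_dens {a b : ℂ} (h : Complex.normSq a - Complex.normSq b = 1) {z : ℂ}
    (hz : z ∈ ball 0 1) :
    |((ContinuousLinearMap.toSpanSingleton ℂ
        (1 / ((starRingEnd ℂ) b * z + (starRingEnd ℂ) a) ^ 2)).restrictScalars ℝ).det| *
      dens (mobius (su11 a b) z) = dens z := by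
  rw [mem_ball_iff_normSq] at hz
  rw [det_restrictScalars_toSpanSingleton, abs_of_nonneg (Complex.normSq_nonneg _)]
  unfold dens
  have := density_invariance h hz
  rw [← this]
  field_simp

/-- **The `lintegral` form of the Möbius invariance of the Poincaré measure**:
`∫⁻ dens · G ∘ (g·) = ∫⁻ dens · G` over the disc, for every `G : ℂ → ℝ≥0∞`. -/
theorem lintegral_ball_comp_mobius (a b : ℂ) (h : Complex.normSq a - Complex.normSq b = 1)
    (G : ℂ → ℝ≥0∞) :
    ∫⁻ z in ball 0 1, ENNReal.ofReal (dens z) * G (mobius (su11 a b) z) =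
      ∫⁻ z in ball 0 1, ENNReal.ofReal (dens z) * G z := by
  have key := lintegral_image_eq_lintegral_abs_det_fderiv_mul volume measurableSet_ball
    (fun z hz => hasFDerivWithinAt_mobius h hz) (mobius_injOn_ball a b h)
    (fun w => ENNReal.ofReal (dens w) * G w)
  rw [mobius_image_ball a b h] at key
  rw [key]
  apply setLIntegral_congr_fun measurableSet_ball
  intro z hz
  dsimp only
  rw [← mul_assoc, ← ENNReal.ofReal_mul (abs_nonneg _), abs_det_mul_dens h hz]

/-- **The Poincaré measure is Möbius-invariant** as a measure: `map (g·) poincare = poincare`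
for every `g = su11 a b ∈ SU(1,1)`. -/
theorem map_mobius_poincare (a b : ℂ) (h : Complex.normSq a - Complex.normSq b = 1) :
    map (mobius (su11 a b)) poincare = poincare := by
  ext A hA
  rw [map_apply (measurable_mobius a b) hA]
  unfold poincare
  rw [withDensity_apply _ ((measurable_mobius a b) hA), withDensity_apply _ hA,
    Measure.restrict_restrict ((measurable_mobius a b) hA), Measure.restrict_restrict hA]
  have e1 : ∫⁻ z in mobius (su11 a b) ⁻¹' A ∩ ball 0 1, ENNReal.ofReal (dens z) =
      ∫⁻ z in ball 0 1, ENNReal.ofReal (dens z) * A.indicator 1 (mobius (su11 a b) z) := by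
    rw [← Measure.restrict_restrict ((measurable_mobius a b) hA),
      ← lintegral_indicator ((measurable_mobius a b) hA)]
    congr 1
    ext z
    by_cases hzA : mobius (su11 a b) z ∈ A
    · simp [hzA]
    · simp [hzA]
  have e2 : ∫⁻ z in A ∩ ball 0 1, ENNReal.ofReal (dens z) =
      ∫⁻ z in ball 0 1, ENNReal.ofReal (dens z) * A.indicator 1 z := by
    rw [← Measure.restrict_restrict hA, ← lintegral_indicator hA]
    congr 1
    ext z
    by_cases hzA : z ∈ A
    · simp [hzA]
    · simp [hzA]
  rw [e1, e2]
  exact lintegral_ball_comp_mobius a b h (A.indicator 1)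

end Summit.Ventures.HodgeRepro2.T5PoincareMeasure
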